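import Literature.AlgebraicGeometry.HodgeTheory.SymbolClasses
import Literature.AlgebraicGeometry.HodgeTheory.ComplexifiedDeRhamFamily
import Literature.NumberTheory.Transcendental.DeRhamTheoremMultiplicative
import Literature.AlgebraicGeometry.HodgeTheory.HardLefschetzNFoldHolds
import Literature.AlgebraicGeometry.HodgeTheory.AlgebraicClassesHodgeTypeHolds
import Literature.AlgebraicGeometry.HodgeTheory.CupPreservesHodgeTypeOfDeRham
import Summits.HodgeConjecture.HodgeConjecture.Theorems.MilnorKExponentialSymbolLiftRCupStepChains
import Summits.HodgeConjecture.HodgeConjecture.Theorems.MilnorKExponentialSymbolLiftRCupStepZigzag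
import HarnessLib

/-!
# Stub `stub_cupStep` (S3) of the line `lefschetz-fold`, crux `SymbolLiftR` (route `MilnorKExponential`)

On a Hodge model `A` whose de Rham comparison is de Rham's integration comparison rescaled by
`(2πi)^{-k/2}` and which carries the weight-one Milnor symbol cocycles of all rational `(1,1)`-classes,
the Lefschetz operator `h ∪ ·` of a hard-Lefschetz datum carries weight-`(q+1)` symbol cocycles to
weight-`(q+2)` symbol cocycles (item stmt-HodgeConjecture-18702, stub S3). Mechanism (Bott–Tu (1982),
§8–§9 and Thm. 14.28: the Čech–de Rham isomorphism is multiplicative): on the product cover, the Čech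
cup product of the Milnor cocycle `σ` of `c` (front face) with the weight-one cocycle `τ` of `h` (back
edge) is a Milnor cocycle of weight `q + 2` (`isMilnorSymbolCocycle_cupChain`,
`{f₁,…,f_{q+1}} · {g} = {f₁,…,f_{q+1},g}`, relations slotwise); its symbol forms are
`symbolForm σ ∧ dlog g` (`symbolForm_mulChain`); the zig-zags of `σ` (bottom `θ`) and of `τ`
(bottom `θ_h`), refined to the product cover (`isTransgression_comap`), multiply to a zig-zag of the
product with bottom `(-1)^{q+1} θ ∧ θ_h` (`isTransgression_cup`); finally
`A.deRham[θ ∧ θ_h] = (2πi)^{-(q+2)} e[θ] ∪ e[θ_h] = m m₁ A^*c ∪ A^*h = m m₁ A^*(h ∪ c)` by the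
multiplicativity of the integration comparison (Warner Thm. 5.45, `complexifyFun_mk_wedge`), graded
commutativity of the cup product in even degrees and multiplicativity of pull-backs. The companion
files `…CupStepDefs/Chains/Forms/Zigzag` hold the cup products and their Leibniz rules.

## References

* R. Bott, L. W. Tu, *Differential Forms in Algebraic Topology* (1982), §8 (8.4), Prop. 8.8, Thm. 14.28.
* F. W. Warner, *Foundations of Differentiable Manifolds and Lie Groups* (1983), Thm. 2.20, Thm. 5.45.
* J. Milnor, *Introduction to Algebraic K-Theory* (1971), §11.
-/

noncomputable section

-- the mandated namespace `Summit.HodgeConjecture.HodgeConjecture.…` repeats a component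
set_option linter.dupNamespace false

open scoped Manifold ContDiff

namespace Summit.HodgeConjecture.HodgeConjecture.Theorems.SymbolLiftR

open Literature.AlgebraicGeometry Literature.AlgebraicGeometry.HodgeTheory
open Literature.Geometry.Kaehler Literature.NumberTheory.Transcendental

open CupStep Literature.AlgebraicTopology.SingularHomology Literature.AlgebraicGeometry.Modules in
/-- **S3 of the line `lefschetz-fold` (the cup step): the Lefschetz operator carries symbol
cocycles to symbol cocycles, raising the weight by one.** On a Hodge model `A` of a smooth
projective complex `n`-fold whose de Rham comparison is de Rham's integration comparison rescaled by
`(2πi)^{-k/2}` and which carries weight-one Milnor symbol cocycles of all rational `(1,1)`-classes,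
for a hard-Lefschetz datum `Λ` (whose class `h` is rational and algebraic, hence of type `(1,1)`):
if `c ∈ H^{2(q+1)}(X(ℂ); ℂ)` has a weight-`(q+1)` symbol cocycle on `A` then `h ∪ c` has a
weight-`(q+2)` symbol cocycle on `A`. Proof: on the product of the two covers, the Čech cup product of
the Milnor cocycle of `c` with the weight-one cocycle of `h` is a Milnor cocycle
(`isMilnorSymbolCocycle_cupChain`), its symbol forms are the wedges of the symbol forms
(`symbolForm_mulChain`), the two zig-zags multiply to a zig-zag with bottom `(-1)^{q+1} θ ∧ θ_h`
(`isTransgression_cup`), and `A.deRham[θ ∧ θ_h] = (2πi)^{-(q+2)} e[θ] ∪ e[θ_h] = m m₁ A^*c ∪ A^*h =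
m m₁ A^*(h ∪ c)` by the multiplicativity of the integration comparison (Warner Thm. 5.45), graded
commutativity of `∪` in even degrees and multiplicativity of pull-backs.
[cite: BottTu1982Forms, §8 Prop. 8.8 and Thm. 14.28] [cite: WarnerGTM94, Thm. 5.45] -/
theorem stub_cupStep : ∀ ⦃n : ℕ⦄ ⦃X : Motives.SchemeOver ℂ⦄, Motives.IsSmoothProjective n X → ∀ (Λ : HardLefschetzNFold n X) (A : HodgeModel n X), (∀ (k : ℕ) (y : complexDeRhamCohomology A.model A.carrier k), A.deRham A.carrier k y = ((2 * (Real.pi : ℂ) * Complex.I) ^ (k / 2))⁻¹ • (integrationDeRhamIsoFamily A.model).complexify A.carrier k y) → (∀ c : complexBetti X (2 * (0 + 1)), IsRationalClass c → IsOfHodgeType n X (2 * (0 + 1)) (0 + 1) (0 + 1) c → A.HasSymbolCocycle 0 c) → ∀ (q : ℕ) (c : complexBetti X (2 * (q + 1))), q + 2 ≤ n → A.HasSymbolCocycle q c → A.HasSymbolCocycle (q + 1) (lefschetzOperator Λ.hyperplaneClass (two_add_two_mul (q + 1)) c) := by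
  intro n X hX Λ A hA hone q c _ hc
  -- the weight-one cocycle of the hyperplane class
  have hh : IsOfHodgeType n X (2 * (0 + 1)) (0 + 1) (0 + 1) Λ.hyperplaneClass :=
    isOfHodgeType_of_mem_algebraicClasses_of_isSmoothProjective hX 1 Λ.hyperplaneClass_mem
  obtain ⟨ι', _, U', hU', hcov', τ, hτ, θh, m₁, hm₁, hTh, hch⟩ :=
    hone Λ.hyperplaneClass Λ.isRationalClass_hyperplaneClass hh
  obtain ⟨ι, _, U, hU, hcov, σ, hσ, θ, m, hm, hT, hcθ⟩ := hc
  -- the product cover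
  let V : ι × ι' → Set A.carrier := fun k ↦ U k.1 ∩ U' k.2
  have hV : ∀ k, IsOpen (V k) := fun k ↦ (hU k.1).inter (hU' k.2)
  have hcovV : ∀ x, ∃ k, x ∈ V k := fun x ↦ by
    obtain ⟨i, hi⟩ := hcov x
    obtain ⟨i', hi'⟩ := hcov' x
    exact ⟨(i, i'), hi, hi'⟩
  have hV₁ : ∀ k, V k ⊆ U k.1 := fun k ↦ Set.inter_subset_left
  have hV₂ : ∀ k, V k ⊆ U' k.2 := fun k ↦ Set.inter_subset_right
  -- the refined cocycles and their cup product
  let σ' : (Fin (q + 2) → ι × ι') → ((Fin (q + 1) → A.carrier → ℂ) →₀ ℤ) := fun J ↦ σ (Prod.fst ∘ J)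
  let τ' : (Fin 2 → ι × ι') → ((Fin 1 → A.carrier → ℂ) →₀ ℤ) := fun J ↦ τ (Prod.snd ∘ J)
  let ρ : (Fin (q + 1 + 2) → ι × ι') → ((Fin (q + 1 + 1) → A.carrier → ℂ) →₀ ℤ) := fun J ↦
    mulChain (q + 1) (σ' (J ∘ Fin.castSucc)) (τ' (Cech.back (q + 1) J))
  have hσ' : IsMilnorSymbolCocycle A.model V σ' := isMilnorSymbolCocycle_comap hσ Prod.fst hV₁
  have hτ' : IsMilnorSymbolCocycle A.model V τ' := isMilnorSymbolCocycle_comap hτ Prod.snd hV₂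
  have hρ : IsMilnorSymbolCocycle A.model V ρ := isMilnorSymbolCocycle_cupChain hσ' hτ'
  -- the refined transgressions and their product
  have hθsc := (mem_cclosedSmoothForms_iff _).1 θ.2
  have hT₁ : IsTransgression hV q (fun J ↦ symbolForm A.model (q + 1) (σ' J))
      (θ : MForm 𝓘(ℝ, A.model) A.carrier ℂ (2 * q + 1 + 1)) :=
    isTransgression_comap hV hT Prod.fst hV₁
  have hT₂ : IsTransgression hV 0 (fun J ↦ symbolForm A.model (0 + 1) (τ' J))
      (θh : MForm 𝓘(ℝ, A.model) A.carrier ℂ (2 * 0 + 1 + 1)) :=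
    isTransgression_comap hV hTh Prod.snd hV₂
  have hT₃ := isTransgression_cup hV hT₁ hT₂ hθsc.1 hθsc.2
  let θ₂ : MForm 𝓘(ℝ, A.model) A.carrier ℂ (2 * (q + 1) + 1 + 1) :=
    (-1 : ℝ) ^ (q + 1) • (θ : MForm 𝓘(ℝ, A.model) A.carrier ℂ (2 * q + 1 + 1)).wedge
      (θh : MForm 𝓘(ℝ, A.model) A.carrier ℂ (2 * 0 + 1 + 1))
  have hT₄ : IsTransgression hV (q + 1) (fun J ↦ symbolForm A.model (q + 1 + 1) (ρ J)) θ₂ :=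
    isTransgression_congr_top hV hT₃ fun J z _ ↦ by
      change ((symbolForm A.model (q + 1) (σ' (J ∘ Fin.castSucc))).wedge
        (symbolForm A.model 1 (τ' (Cech.back (q + 1) J)))) z =
        symbolForm A.model (q + 1 + 1)
          (mulChain (q + 1) (σ' (J ∘ Fin.castSucc)) (τ' (Cech.back (q + 1) J))) z
      rw [symbolForm_mulChain]
  -- the bottom form is closed and smooth (the product cover covers)
  have hθ₂mem : θ₂ ∈ cclosedSmoothForms A.model A.carrier (2 * (q + 1) + 1 + 1) := by
    rw [mem_cclosedSmoothForms_iff]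
    exact ⟨hT₄.isSmoothForm hcovV, hT₄.isClosedForm hcovV⟩
  refine ⟨ι × ι', inferInstance, V, hV, hcovV, ρ, hρ, ⟨θ₂, hθ₂mem⟩,
    (-1) ^ (q + 1) * m * m₁, mul_ne_zero (mul_ne_zero (pow_ne_zero _ (by norm_num)) hm) hm₁, hT₄, ?_⟩
  -- the comparison: multiplicativity of the integration comparison
  haveI : WedgeFacts 𝓘(ℝ, A.model) A.carrier ℝ :=
    wedgeFacts_of_assoc 𝓘(ℝ, A.model) A.carrier ℝ (ContinuousAlternatingMap.WedgeAssoc_holds ℝ A.model ℝ)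
  haveI : WedgeFacts 𝓘(ℝ, A.model) A.carrier ℂ :=
    wedgeFacts_of_assoc 𝓘(ℝ, A.model) A.carrier ℂ (ContinuousAlternatingMap.WedgeAssoc_holds ℝ A.model ℂ)
  have h2πi : (2 * (Real.pi : ℂ) * Complex.I) ≠ 0 :=
    mul_ne_zero (mul_ne_zero two_ne_zero (Complex.ofReal_ne_zero.2 Real.pi_ne_zero)) Complex.I_ne_zero
  let e := (integrationDeRhamIsoFamily A.model).complexify
  have hA' : ∀ (k : ℕ) (y : complexDeRhamCohomology A.model A.carrier k), A.deRham A.carrier k y =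
      ((2 * (Real.pi : ℂ) * Complex.I) ^ (k / 2))⁻¹ • e A.carrier k y := hA
  have he : (integrationDeRhamIsoFamily A.model).IsMultiplicative :=
    integrationDeRhamIsoFamily_isMultiplicative
  have hθe : e A.carrier (2 * q + 1 + 1) (complexDeRhamCohomology.mk A.model A.carrier (2 * q + 1 + 1) θ) =
      (2 * (Real.pi : ℂ) * Complex.I) ^ (q + 1) • (m : ℂ) • A.pullback (2 * q + 1 + 1) c := by
    have h := hA' (2 * q + 1 + 1) (complexDeRhamCohomology.mk A.model A.carrier (2 * q + 1 + 1) θ)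
    rw [hcθ, show (2 * q + 1 + 1) / 2 = q + 1 by omega] at h
    exact (inv_smul_eq_iff₀ (pow_ne_zero _ h2πi)).1 h.symm
  have hθhe : e A.carrier (2 * 0 + 1 + 1)
      (complexDeRhamCohomology.mk A.model A.carrier (2 * 0 + 1 + 1) θh) =
      (2 * (Real.pi : ℂ) * Complex.I) ^ 1 • (m₁ : ℂ) • A.pullback (2 * 0 + 1 + 1) Λ.hyperplaneClass := by
    have h := hA' (2 * 0 + 1 + 1) (complexDeRhamCohomology.mk A.model A.carrier (2 * 0 + 1 + 1) θh)
    rw [hch, show (2 * 0 + 1 + 1) / 2 = 1 from rfl] at h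
    exact (inv_smul_eq_iff₀ (pow_ne_zero _ h2πi)).1 h.symm
  have hmem' : (θ : MForm 𝓘(ℝ, A.model) A.carrier ℂ (2 * q + 1 + 1)).wedge
      (θh : MForm 𝓘(ℝ, A.model) A.carrier ℂ (2 * 0 + 1 + 1)) ∈
        cclosedSmoothForms A.model A.carrier (2 * (q + 1) + 1 + 1) :=
    wedge_mem_cclosedSmoothForms θ.2 θh.2
  have hdeg₁ : 2 * q + 1 + 1 + (2 * 0 + 1 + 1) = 2 * (q + 1) + 1 + 1 := rfl
  have hdeg₂ : 2 * 0 + 1 + 1 + (2 * q + 1 + 1) = 2 * (q + 1) + 1 + 1 := by omega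
  have hmul : e A.carrier (2 * (q + 1) + 1 + 1)
      (complexDeRhamCohomology.mk A.model A.carrier (2 * (q + 1) + 1 + 1) ⟨_, hmem'⟩) =
      cupProduct hdeg₁
        (e A.carrier (2 * q + 1 + 1) (complexDeRhamCohomology.mk A.model A.carrier (2 * q + 1 + 1) θ))
        (e A.carrier (2 * 0 + 1 + 1) (complexDeRhamCohomology.mk A.model A.carrier (2 * 0 + 1 + 1) θh)) :=
    complexifyFun_mk_wedge he θ θh
  have hθ₂eq : (⟨θ₂, hθ₂mem⟩ : cclosedSmoothForms A.model A.carrier (2 * (q + 1) + 1 + 1)) =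
      ((-1 : ℂ) ^ (q + 1)) • (⟨_, hmem'⟩ : cclosedSmoothForms A.model A.carrier (2 * (q + 1) + 1 + 1)) := by
    apply Subtype.ext
    rw [Submodule.coe_smul]
    change ((-1 : ℝ) ^ (q + 1) • (θ : MForm 𝓘(ℝ, A.model) A.carrier ℂ (2 * q + 1 + 1)).wedge
      (θh : MForm 𝓘(ℝ, A.model) A.carrier ℂ (2 * 0 + 1 + 1))) =
      ((-1 : ℂ) ^ (q + 1)) • (θ : MForm 𝓘(ℝ, A.model) A.carrier ℂ (2 * q + 1 + 1)).wedge
        (θh : MForm 𝓘(ℝ, A.model) A.carrier ℂ (2 * 0 + 1 + 1))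
    rw [← algebraMap_smul ℂ ((-1 : ℝ) ^ (q + 1)), map_pow, map_neg, map_one]
  have hpull : A.pullback (2 * (q + 1) + 1 + 1) (cupProduct (two_add_two_mul (q + 1)) Λ.hyperplaneClass c) =
      cupProduct hdeg₂ (A.pullback (2 * 0 + 1 + 1) Λ.hyperplaneClass) (A.pullback (2 * q + 1 + 1) c) :=
    cupProduct_map _ _ _ _
  rw [hθ₂eq, map_smul, map_smul, hA', show (2 * (q + 1) + 1 + 1) / 2 = q + 1 + 1 by omega, hmul, hθe, hθhe]
  simp only [map_smul, LinearMap.smul_apply, smul_smul]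
  rw [lefschetzOperator_apply, hpull, cupProduct_gradedComm_holds ℂ A.carrier hdeg₁ hdeg₂
    (A.pullback (2 * q + 1 + 1) c) (A.pullback (2 * 0 + 1 + 1) Λ.hyperplaneClass), smul_smul]
  congr 1
  rw [show (2 * q + 1 + 1) * (2 * 0 + 1 + 1) = 2 * (2 * q + 2) by ring, pow_mul, neg_one_sq, one_pow, mul_one]
  push_cast
  field_simp
  ring

end Summit.HodgeConjecture.HodgeConjecture.Theorems.SymbolLiftR
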